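import Mathlib
import HarnessLib
import Summits.Ventures.LatticeQCDFlow.Exactness.LatticeEfronStein

/-!
# The bounded-differences inequalities on a finite product of probability spaces: McDiarmid's exponential-moment bound `E e^{t(G − EG)} ≤ exp(t²·Σ_k D_k²/8)` and the variance bound `Var(G) ≤ Σ_k D_k²/4`

HONEST FRAMING: exact (Metropolis-corrected) sampling algorithms for lattice gauge theory;
figures of merit are autocorrelation/cost numbers at stated couplings and volumes; no
continuum-physics claim.

Venture `LatticeQCDFlow` (cell pub-lqcd), topic `Exactness`; FANOUT row 7 (`s0-cpn-null`).  NEW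
WORK of the cell over Mathlib (Hoeffding's lemma `ProbabilityTheory.hasSubgaussianMGF_of_mem_Icc`)
and the tree's `Exactness/LatticeCoordAvg.lean` / `Exactness/LatticeEfronStein.lean` (GEN-8: the
coordinate averages `A_s`, `A_{s∪{k}} = A_s∘A_k`, mean preservation, the Efron–Stein inequality);
nothing is cited as a fact.  Printed counterpart, NAMED ONLY: C. McDiarmid, *On the method of
bounded differences*, Surveys in Combinatorics 1989, LMS LN 141, Lemma (1.2) and its martingale
proof; W. Hoeffding, JASA 58 (1963) 13, eq. (4.16); T. Popoviciu's variance inequality [folklore].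
The tree's `Literature/Probability/Moments/McDiarmidWeighted.lean` proves McDiarmid's inequality for
FINITE alphabets in weighted-sum language; THIS FILE is the continuous-coordinate version the
lattice of site spheres needs (compact metric coordinate space, Borel probability law, continuous
functionals), stated as the exponential-moment bound from which tail bounds follow by Chernoff.

## Setting

`ι` a finite index set (the lattice), `X` a compact metric space with a Borel probability measure
`μ`, `π = ⊗_{i∈ι} μ` on `ι → X`, `G : (ι → X) → ℝ` continuous with BOUNDED DIFFERENCES
`G(ω[k ← v]) − G(ω[k ← v']) ≤ D_k` for all `ω, k, v, v'`.

## Content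

* §1 one coordinate: `exists_Icc_of_bddDiff` (the section `v ↦ H(ω[k←v])` lives in an interval of
  length `≤ D_k`), **`integral_exp_mul_sub_le_of_bddDiff`** (conditional Hoeffding:
  `∫ e^{t(H(ω[k←v]) − ∫H(ω[k←u])dμ)} dμ(v) ≤ e^{t²D_k²/8}`), **`integral_sq_sub_le_of_bddDiff`**
  (conditional Popoviciu: `∫ (H(ω[k←v]) − ∫H(ω[k←u])dμ)² dμ(v) ≤ D_k²/4`).
* §2 averaging preserves the hypotheses: `bddDiff_nonneg`, `coordAvg_singleton_update`
  (`A_kG` ignores coordinate `k`), `coordAvg_update_of_forall` (`A_s` keeps `k`-independence for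
  `k ∉ s`), **`bddDiff_coordAvg_singleton`** (`A_kG` has the same bounded differences).
* §3 **`integral_exp_mul_sub_coordAvg_le`** — THE PEELING INDUCTION: for every `s ⊆ ι`,
  `∫ e^{t(G − A_sG)} dπ ≤ exp(t²·Σ_{k∈s} D_k²/8)` (reveal one coordinate of `s` at a time; the
  increment `G − A_kG` is conditionally centred with range `≤ D_k`).
* §4 **`mcdiarmid_integral_exp_le`** — McDIARMID'S EXPONENTIAL-MOMENT BOUND
  `∫ e^{t(G − ∫G dπ)} dπ ≤ exp(t²·Σ_k D_k²/8)` for every real `t`;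
  **`variance_le_of_bddDiff`** — `∫ (G − ∫G dπ)² dπ ≤ (Σ_k D_k²)/4` (Efron–Stein + Popoviciu).

NOT CLAIMED: the tail form (one Chernoff step away), non-continuous `G`, infinite products,
anything about lattice models (sequel `Exactness/SphereLOFlowEffectiveActionConcentration.lean`).
-/

noncomputable section

namespace Summit.Ventures.LatticeQCDFlow.Exactness

open MeasureTheory Function ProbabilityTheory Set
open scoped ENNReal NNReal

variable {ι : Type*} [Fintype ι] [DecidableEq ι]
variable {X : Type*} [MeasurableSpace X] [MetricSpace X] [CompactSpace X] [BorelSpace X]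
variable (μ : Measure X) [IsProbabilityMeasure μ]

/-! ## §1 One coordinate: Hoeffding's lemma and Popoviciu's inequality for a section -/

section OneCoordinate

omit [Fintype ι] [DecidableEq ι] [MetricSpace X] [CompactSpace X] [BorelSpace X] in
/-- A probability space is nonempty. -/
theorem nonempty_of_isProbabilityMeasure (ν : Measure X) [IsProbabilityMeasure ν] : Nonempty X := by
  by_contra h
  rw [not_nonempty_iff] at h
  have h1 : ν univ = 1 := measure_univ
  rw [univ_eq_empty_iff.2 h, measure_empty] at h1
  exact zero_ne_one h1

omit [Fintype ι] [MeasurableSpace X] [BorelSpace X] in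
/-- **The section of a bounded-difference functional lives in an interval of length `≤ D`.** -/
theorem exists_Icc_of_bddDiff [Nonempty X] {H : (ι → X) → ℝ} (hH : Continuous H) {k : ι} {D : ℝ}
    (ω : ι → X) (hD : ∀ v v', H (update ω k v) - H (update ω k v') ≤ D) :
    ∃ a b : ℝ, a ≤ b ∧ b - a ≤ D ∧ ∀ v, H (update ω k v) ∈ Icc a b := by
  have hY : Continuous fun v : X => H (update ω k v) := hH.comp (continuous_update_right ω k)
  obtain ⟨v₀, -, hv₀⟩ := isCompact_univ.exists_isMinOn univ_nonempty hY.continuousOn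
  obtain ⟨v₁, -, hv₁⟩ := isCompact_univ.exists_isMaxOn univ_nonempty hY.continuousOn
  have h₀ : ∀ v, H (update ω k v₀) ≤ H (update ω k v) := fun v => hv₀ (mem_univ v)
  have h₁ : ∀ v, H (update ω k v) ≤ H (update ω k v₁) := fun v => hv₁ (mem_univ v)
  exact ⟨H (update ω k v₀), H (update ω k v₁), h₀ v₁, hD v₁ v₀, fun v => ⟨h₀ v, h₁ v⟩⟩

omit [Fintype ι] in
/-- A continuous function on the compact coordinate space is integrable. -/
theorem integrable_section {H : (ι → X) → ℝ} (hH : Continuous H) (k : ι) (ω : ι → X) :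
    Integrable (fun v : X => H (update ω k v)) μ :=
  (hH.comp (continuous_update_right ω k)).integrable_of_hasCompactSupport
    (HasCompactSupport.of_compactSpace _)

omit [Fintype ι] in
/-- **CONDITIONAL HOEFFDING**: for a continuous `H` whose `k`-section at `ω` has differences
`≤ D`, `∫ exp(t·(H(ω[k←v]) − ∫ H(ω[k←u]) dμ(u))) dμ(v) ≤ exp(t²·D²/8)` (Hoeffding's lemma for the
centred section, Mathlib `hasSubgaussianMGF_of_mem_Icc`). -/
theorem integral_exp_mul_sub_le_of_bddDiff {H : (ι → X) → ℝ} (hH : Continuous H) {k : ι} {D : ℝ}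
    (ω : ι → X) (hD : ∀ v v', H (update ω k v) - H (update ω k v') ≤ D) (t : ℝ) :
    ∫ v, Real.exp (t * (H (update ω k v) - ∫ u, H (update ω k u) ∂μ)) ∂μ ≤
      Real.exp (t ^ 2 * D ^ 2 / 8) := by
  haveI : Nonempty X := nonempty_of_isProbabilityMeasure μ
  obtain ⟨a, b, hab, hba, hmem⟩ := exists_Icc_of_bddDiff hH ω hD
  have hm : AEMeasurable (fun v : X => H (update ω k v)) μ :=
    (hH.comp (continuous_update_right ω k)).measurable.aemeasurable
  have hsg := hasSubgaussianMGF_of_mem_Icc (X := fun v : X => H (update ω k v)) hm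
    (ae_of_all _ hmem)
  have h := hsg.mgf_le t
  simp only [mgf] at h
  refine h.trans (Real.exp_le_exp.2 ?_)
  push_cast
  rw [Real.norm_eq_abs, abs_of_nonneg (sub_nonneg.2 hab)]
  have hD0 : 0 ≤ D := le_trans (sub_nonneg.2 hab) hba
  have h2 : (b - a) ^ 2 ≤ D ^ 2 := pow_le_pow_left₀ (sub_nonneg.2 hab) hba 2
  nlinarith [sq_nonneg t]

omit [Fintype ι] in
/-- **CONDITIONAL POPOVICIU**: for a continuous `H` whose `k`-section at `ω` has differences `≤ D`,
`∫ (H(ω[k←v]) − ∫ H(ω[k←u]) dμ(u))² dμ(v) ≤ D²/4`. -/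
theorem integral_sq_sub_le_of_bddDiff {H : (ι → X) → ℝ} (hH : Continuous H) {k : ι} {D : ℝ}
    (ω : ι → X) (hD : ∀ v v', H (update ω k v) - H (update ω k v') ≤ D) :
    ∫ v, (H (update ω k v) - ∫ u, H (update ω k u) ∂μ) ^ 2 ∂μ ≤ D ^ 2 / 4 := by
  haveI : Nonempty X := nonempty_of_isProbabilityMeasure μ
  obtain ⟨a, b, hab, hba, hmem⟩ := exists_Icc_of_bddDiff hH ω hD
  set Y : X → ℝ := fun v => H (update ω k v) with hY
  set m : ℝ := ∫ u, Y u ∂μ with hm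
  have hYi : Integrable Y μ := integrable_section μ hH k ω
  -- `(Y − m)² = (Y − a)(Y − b) + (a + b − 2m)(Y − m) + (m − a)(b − m)`
  have hdec : ∀ v, (Y v - m) ^ 2 =
      (Y v - a) * (Y v - b) + ((a + b - 2 * m) * (Y v - m) + (m - a) * (b - m)) := by
    intro v; ring
  have hYc : Continuous Y := hH.comp (continuous_update_right ω k)
  have hi1 : Integrable (fun v => (Y v - a) * (Y v - b)) μ :=
    ((hYc.sub continuous_const).mul (hYc.sub continuous_const)).integrable_of_hasCompactSupport
      (HasCompactSupport.of_compactSpace _)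
  have hi3 : Integrable (fun v => (a + b - 2 * m) * (Y v - m)) μ :=
    (hYi.sub (integrable_const m)).const_mul (a + b - 2 * m)
  have hi2 : Integrable (fun v => (a + b - 2 * m) * (Y v - m) + (m - a) * (b - m)) μ :=
    hi3.add (integrable_const _)
  have hneg : ∫ v, (Y v - a) * (Y v - b) ∂μ ≤ 0 := by
    refine integral_nonpos fun v => ?_
    have h1 : 0 ≤ Y v - a := sub_nonneg.2 (hmem v).1
    have h2 : Y v - b ≤ 0 := sub_nonpos.2 (hmem v).2
    exact mul_nonpos_of_nonneg_of_nonpos h1 h2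
  have hsub : ∫ v, (Y v - m) ∂μ = 0 := by
    rw [integral_sub hYi (integrable_const m), integral_const, smul_eq_mul, probReal_univ, one_mul,
      ← hm, sub_self]
  have hlin : ∫ v, ((a + b - 2 * m) * (Y v - m) + (m - a) * (b - m)) ∂μ = (m - a) * (b - m) := by
    rw [integral_add hi3 (integrable_const _), integral_const_mul, hsub, mul_zero, zero_add,
      integral_const, smul_eq_mul, probReal_univ, one_mul]
  have hkey : ∫ v, (Y v - m) ^ 2 ∂μ ≤ (m - a) * (b - m) := by
    simp_rw [hdec]
    rw [integral_add hi1 hi2, hlin]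
    linarith
  have hamgm : (m - a) * (b - m) ≤ D ^ 2 / 4 := by
    have h2 : (b - a) ^ 2 ≤ D ^ 2 := pow_le_pow_left₀ (sub_nonneg.2 hab) hba 2
    nlinarith [sq_nonneg (m - a - (b - m))]
  exact hkey.trans hamgm

end OneCoordinate

/-! ## §2 Averaging preserves bounded differences and coordinate-independence -/

section Averaging

omit [Fintype ι] [DecidableEq ι] [MeasurableSpace X] [MetricSpace X] [CompactSpace X] [BorelSpace X] in
/-- Bounded differences are nonnegative. -/
theorem bddDiff_nonneg [DecidableEq ι] [Nonempty X] {G : (ι → X) → ℝ} {D : ι → ℝ}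
    (hD : ∀ ω k v v', G (update ω k v) - G (update ω k v') ≤ D k) (ω : ι → X) (k : ι) : 0 ≤ D k := by
  have h := hD ω k (Classical.arbitrary X) (Classical.arbitrary X)
  rwa [sub_self] at h

omit [MetricSpace X] [CompactSpace X] [BorelSpace X] [IsProbabilityMeasure μ] in
/-- **`A_kG` ignores coordinate `k`.** -/
theorem coordAvg_singleton_update (k : ι) (G : (ι → X) → ℝ) (ω : ι → X) (v : X) :
    coordAvg μ {k} G (update ω k v) = coordAvg μ {k} G ω := by
  have h := coordAvg_apply_piecewise μ {k} G ω (fun _ => v)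
  rwa [Finset.piecewise_singleton] at h

omit [MetricSpace X] [CompactSpace X] [BorelSpace X] [IsProbabilityMeasure μ] in
/-- **`A_s` preserves independence of coordinate `k ∉ s`.** -/
theorem coordAvg_update_of_forall {s : Finset ι} {k : ι} (hk : k ∉ s) {H : (ι → X) → ℝ}
    (hH : ∀ ω v, H (update ω k v) = H ω) (ω : ι → X) (v : X) :
    coordAvg μ s H (update ω k v) = coordAvg μ s H ω := by
  unfold coordAvg
  refine integral_congr_ae (ae_of_all _ fun ω' => ?_)
  simp only
  rw [← Finset.update_piecewise_of_notMem _ _ _ hk, hH]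

omit [Fintype ι] in
/-- **`A_kG` has the bounded differences of `G`.** -/
theorem bddDiff_coordAvg_singleton {G : (ι → X) → ℝ} (hG : Continuous G) {D : ι → ℝ}
    (hD : ∀ ω j v v', G (update ω j v) - G (update ω j v') ≤ D j) (k : ι) [Fintype ι] :
    ∀ ω j v v', coordAvg μ {k} G (update ω j v) - coordAvg μ {k} G (update ω j v') ≤ D j := by
  haveI : Nonempty X := nonempty_of_isProbabilityMeasure μ
  intro ω j v v'
  by_cases hjk : j = k
  · subst hjk
    rw [coordAvg_singleton_update, coordAvg_singleton_update, sub_self]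
    exact bddDiff_nonneg hD ω j
  · rw [coordAvg_singleton μ k hG, coordAvg_singleton μ k hG,
      ← integral_sub (integrable_section μ hG k _) (integrable_section μ hG k _)]
    calc ∫ u, (G (update (update ω j v) k u) - G (update (update ω j v') k u)) ∂μ
        ≤ ∫ _u, D j ∂μ := by
          refine integral_mono ((integrable_section μ hG k _).sub (integrable_section μ hG k _))
            (integrable_const _) fun u => ?_
          have hc : ∀ w : X, update (update ω j w) k u = update (update ω k u) j w :=
            fun w => update_comm hjk w u ω
          simp only
          rw [hc v, hc v']
          exact hD _ j v v'
      _ = D j := by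
          simp only [integral_const, smul_eq_mul, Measure.real, measure_univ, ENNReal.toReal_one,
            one_mul]

end Averaging

/-! ## §3 The peeling induction -/

section Peeling

/-- **THE PEELING INDUCTION**: for every `s ⊆ ι`, every continuous `G` with bounded differences
`D` and every real `t`, `∫ exp(t·(G − A_sG)) dπ ≤ exp(t²·Σ_{k∈s} D_k²/8)` (reveal the coordinates
of `s` one at a time: `G − A_{s∪{k}}G = (G − A_kG) + (A_kG − A_s A_kG)`, the second summand does not
see coordinate `k`, and the first is conditionally centred with range `≤ D_k`). -/
theorem integral_exp_mul_sub_coordAvg_le (s : Finset ι) :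
    ∀ {G : (ι → X) → ℝ}, Continuous G → ∀ {D : ι → ℝ},
      (∀ ω k v v', G (update ω k v) - G (update ω k v') ≤ D k) → ∀ t : ℝ,
      ∫ ω, Real.exp (t * (G ω - coordAvg μ s G ω)) ∂Measure.pi (fun _ : ι => μ) ≤
        Real.exp (t ^ 2 * (∑ k ∈ s, D k ^ 2) / 8) := by
  induction s using Finset.induction_on with
  | empty =>
    intro G _ D _ t
    simp [coordAvg_empty]
  | insert k s hk ih =>
    intro G hG D hD t
    -- the averaged functional `G' = A_kG`
    set G' : (ι → X) → ℝ := coordAvg μ {k} G with hG'def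
    have hG'c : Continuous G' := continuous_coordAvg μ {k} hG
    have hG'D : ∀ ω j v v', G' (update ω j v) - G' (update ω j v') ≤ D j :=
      bddDiff_coordAvg_singleton μ hG hD k
    have hAs : Continuous (coordAvg μ s G') := continuous_coordAvg μ s hG'c
    -- the two factors
    set Ψ : (ι → X) → ℝ := fun ω => Real.exp (t * (G ω - G' ω)) with hΨ
    set Φ : (ι → X) → ℝ := fun ω => Real.exp (t * (G' ω - coordAvg μ s G' ω)) with hΦ
    have hΨc : Continuous Ψ := Real.continuous_exp.comp (continuous_const.mul (hG.sub hG'c))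
    have hΦc : Continuous Φ := Real.continuous_exp.comp (continuous_const.mul (hG'c.sub hAs))
    -- `Φ` does not see coordinate `k`
    have hG'k : ∀ ω v, G' (update ω k v) = G' ω := fun ω v => coordAvg_singleton_update μ k G ω v
    have hAsk : ∀ ω v, coordAvg μ s G' (update ω k v) = coordAvg μ s G' ω :=
      coordAvg_update_of_forall μ hk hG'k
    have hΦk : ∀ ω ω', Φ (({k} : Finset ι).piecewise ω' ω) = Φ ω := by
      intro ω ω'
      simp only [hΦ, Finset.piecewise_singleton, hG'k, hAsk]
    -- the decomposition of the integrand
    have hdec : ∀ ω, Real.exp (t * (G ω - coordAvg μ (insert k s) G ω)) = Φ ω * Ψ ω := by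
      intro ω
      rw [coordAvg_insert μ hk hG, hΦ, hΨ]
      simp only
      rw [← Real.exp_add]
      congr 1; ring
    simp_rw [hdec]
    -- integrate out coordinate `k` first: `∫ Φ Ψ = ∫ A_k(Φ Ψ) = ∫ Φ · A_k Ψ`
    have hprod : Continuous fun ω => Φ ω * Ψ ω := hΦc.mul hΨc
    rw [← integral_coordAvg μ {k} hprod]
    have hpull : ∀ ω, coordAvg μ {k} (fun ω => Φ ω * Ψ ω) ω = Φ ω * coordAvg μ {k} Ψ ω :=
      fun ω => coordAvg_mul_left μ {k} hΦk ω
    simp_rw [hpull]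
    -- conditional Hoeffding for `A_k Ψ`
    have hHoeff : ∀ ω, coordAvg μ {k} Ψ ω ≤ Real.exp (t ^ 2 * D k ^ 2 / 8) := by
      intro ω
      rw [coordAvg_singleton μ k hΨc]
      have e : ∀ v, Ψ (update ω k v) =
          Real.exp (t * (G (update ω k v) - ∫ u, G (update ω k u) ∂μ)) := by
        intro v
        simp only [hΨ]
        rw [hG'k, hG'def, coordAvg_singleton μ k hG]
      simp_rw [e]
      exact integral_exp_mul_sub_le_of_bddDiff μ hG ω (hD ω k) t
    have hΦ0 : ∀ ω, 0 ≤ Φ ω := fun ω => (Real.exp_pos _).le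
    have hAΨc : Continuous (coordAvg μ {k} Ψ) := continuous_coordAvg μ {k} hΨc
    calc ∫ ω, Φ ω * coordAvg μ {k} Ψ ω ∂Measure.pi (fun _ : ι => μ)
        ≤ ∫ ω, Φ ω * Real.exp (t ^ 2 * D k ^ 2 / 8) ∂Measure.pi (fun _ : ι => μ) :=
          integral_mono (integrable_pi_of_continuous μ (hΦc.mul hAΨc))
            (integrable_pi_of_continuous μ (hΦc.mul continuous_const))
            fun ω => mul_le_mul_of_nonneg_left (hHoeff ω) (hΦ0 ω)
      _ = Real.exp (t ^ 2 * D k ^ 2 / 8) * ∫ ω, Φ ω ∂Measure.pi (fun _ : ι => μ) := by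
          rw [integral_mul_const, mul_comm]
      _ ≤ Real.exp (t ^ 2 * D k ^ 2 / 8) * Real.exp (t ^ 2 * (∑ j ∈ s, D j ^ 2) / 8) :=
          mul_le_mul_of_nonneg_left (ih hG'c hG'D t) (Real.exp_pos _).le
      _ = Real.exp (t ^ 2 * (∑ j ∈ insert k s, D j ^ 2) / 8) := by
          rw [← Real.exp_add, Finset.sum_insert hk]
          congr 1; ring

end Peeling

/-! ## §4 McDiarmid's exponential-moment bound and the variance bound -/

section Main

/-- **McDIARMID'S BOUNDED-DIFFERENCES INEQUALITY, EXPONENTIAL-MOMENT FORM.**  On the finite product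
`π = ⊗_ι μ` of a compact metric probability space, every continuous functional `G` with bounded
differences `G(ω[k←v]) − G(ω[k←v']) ≤ D_k` satisfies, for every real `t`,
`∫ exp(t·(G − ∫G dπ)) dπ ≤ exp(t²·Σ_k D_k²/8)`. -/
theorem mcdiarmid_integral_exp_le {G : (ι → X) → ℝ} (hG : Continuous G) {D : ι → ℝ}
    (hD : ∀ ω k v v', G (update ω k v) - G (update ω k v') ≤ D k) (t : ℝ) :
    ∫ ω, Real.exp (t * (G ω - ∫ ω', G ω' ∂Measure.pi (fun _ : ι => μ))) ∂Measure.pi (fun _ : ι => μ) ≤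
      Real.exp (t ^ 2 * (∑ k, D k ^ 2) / 8) := by
  have h := integral_exp_mul_sub_coordAvg_le μ Finset.univ hG hD t
  simp_rw [coordAvg_univ] at h
  exact h

/-- **THE VARIANCE OF A BOUNDED-DIFFERENCE FUNCTIONAL**: `∫ (G − ∫G dπ)² dπ ≤ (Σ_k D_k²)/4`
(Efron–Stein, then Popoviciu in each coordinate). -/
theorem variance_le_of_bddDiff {G : (ι → X) → ℝ} (hG : Continuous G) {D : ι → ℝ}
    (hD : ∀ ω k v v', G (update ω k v) - G (update ω k v') ≤ D k) :
    ∫ ω, (G ω - ∫ ω', G ω' ∂Measure.pi (fun _ : ι => μ)) ^ 2 ∂Measure.pi (fun _ : ι => μ) ≤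
      (∑ k, D k ^ 2) / 4 := by
  refine (efronStein μ hG).trans ?_
  rw [Finset.sum_div]
  refine Finset.sum_le_sum fun k _ => ?_
  -- `∫ (G − A_kG)² = ∫ A_k[(G − A_kG)²] ≤ D_k²/4`
  have hAk : Continuous (coordAvg μ {k} G) := continuous_coordAvg μ {k} hG
  have hH : Continuous fun ω => (G ω - coordAvg μ {k} G ω) ^ 2 := (hG.sub hAk).pow 2
  rw [← integral_coordAvg μ {k} hH]
  have hpt : ∀ ω, coordAvg μ {k} (fun ω => (G ω - coordAvg μ {k} G ω) ^ 2) ω ≤ D k ^ 2 / 4 := by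
    intro ω
    rw [coordAvg_singleton μ k hH]
    have e : ∀ v, (G (update ω k v) - coordAvg μ {k} G (update ω k v)) ^ 2 =
        (G (update ω k v) - ∫ u, G (update ω k u) ∂μ) ^ 2 := by
      intro v
      rw [coordAvg_singleton_update, coordAvg_singleton μ k hG]
    simp_rw [e]
    exact integral_sq_sub_le_of_bddDiff μ hG ω (hD ω k)
  have hc : Continuous (coordAvg μ {k} fun ω => (G ω - coordAvg μ {k} G ω) ^ 2) :=
    continuous_coordAvg μ {k} hH
  calc ∫ ω, coordAvg μ {k} (fun ω => (G ω - coordAvg μ {k} G ω) ^ 2) ω ∂Measure.pi (fun _ : ι => μ)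
      ≤ ∫ _ω, D k ^ 2 / 4 ∂Measure.pi (fun _ : ι => μ) :=
        integral_mono (integrable_pi_of_continuous μ hc) (integrable_const _) hpt
    _ = D k ^ 2 / 4 := by
        simp only [integral_const, smul_eq_mul, Measure.real, measure_univ, ENNReal.toReal_one,
          one_mul]

end Main

end Summit.Ventures.LatticeQCDFlow.Exactness

end
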